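import Summits.HodgeConjecture.HodgeCM.PerL34.MahlerCriterion_1

/-! PORT of `HodgeCM/PerL34/MahlerCriterion.lean` (HodgeCMPerL run 82) — part 2: continuation of `Summits.HodgeConjecture.HodgeCM.PerL34.MahlerCriterion_1` (split at a top-level declaration boundary by port_pkg.py; scope re-opened below; declarations unchanged). -/

-- port_pkg: scope re-opened for this part (file-level context, then the namespace/section stack open at the cut)
set_option autoImplicit false
noncomputable section
open scoped NNReal MatrixGroups Matrix Pointwise
open NumberField IsDedekindDomain
namespace HodgeCM.PerL34.Mahler
open Literature.NumberTheory Literature.NumberTheory.Automorphic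
section Mahler
variable (n : ℕ) (K : Type) [Field K] [NumberField K]
/-- Mahler's criterion for `GL_{n+1}` (the inductive shape of the index type is used to speak of the
last Minkowski vector). -/
theorem exists_isCompact_rational_mul_succ (c b : ℝ≥0) (hc : 0 < c) :
    ∃ C : Set (GL (Fin (n + 1)) (AdeleRing (𝓞 K) K)), IsCompact C ∧
      ∀ g : GL (Fin (n + 1)) (AdeleRing (𝓞 K) K),
        (∀ ξ : Fin (n + 1) → K, ξ ≠ 0 →
          c ≤ vecHeight K (principalVec K ξ ᵥ* (g : Matrix (Fin (n + 1)) (Fin (n + 1)) (AdeleRing (𝓞 K) K)))) →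
        IdeleClassGroup.ideleNorm K (Matrix.GeneralLinearGroup.det g) ≤ b →
        g ∈ (rationalPointsGL (n + 1) K : Set (GL (Fin (n + 1)) (AdeleRing (𝓞 K) K))) * C := by
  classical
  obtain ⟨t, ht, hred⟩ := exists_minkowskiReduction (n + 1) K
  obtain ⟨CN, hCNc, -, hCN⟩ := exists_isCompact_upperUnitriangular_adele K (n + 1)
  obtain ⟨CM, hCMc, -, hCM⟩ := exists_isCompact_normOneDiagonal_adele (n + 1) K
  obtain ⟨κ, hκ, hκle⟩ := exists_pos_le_ideleNorm_det (n + 1) K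
  -- the constants
  set t₁ : ℝ≥0 := min t.toNNReal 1 with ht₁
  have ht₁t : (t₁ : ℝ) ≤ t := by
    rw [ht₁, NNReal.coe_min, Real.coe_toNNReal t ht.le]; exact min_le_left _ _
  have ht₁1 : t₁ ≤ 1 := min_le_right _ _
  have ht₁0 : 0 < t₁ := lt_min (Real.toNNReal_pos.mpr ht) one_pos
  set ℓ : ℝ≥0 := t₁ ^ n * c with hℓ
  have hℓ0 : 0 < ℓ := mul_pos (pow_pos ht₁0 n) hc
  set U : ℝ≥0 := b / κ / ℓ ^ n with hU
  set lo : ℝ≥0 := min ℓ 1 with hlo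
  set hi : ℝ≥0 := max U 1 with hhi
  have hlo0 : lo ≠ 0 := (lt_min hℓ0 one_pos).ne'
  obtain ⟨Z, hZc, hZ⟩ := exists_isCompact_posRealDiagonal_box (n + 1) K lo hi hlo0
  set d : ℕ := Module.finrank ℚ K with hd
  have hd0 : d ≠ 0 := Module.finrank_pos.ne'
  refine ⟨CN * CM * Z * (standardMaximalCompactGL (n + 1) K : Set (GL (Fin (n + 1)) (AdeleRing (𝓞 K) K))),
    ((hCNc.mul hCMc).mul hZc).mul (isCompact_standardMaximalCompactGL (n + 1) K), ?_⟩
  intro g hheight hdet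
  obtain ⟨γ, u, hu, m, k, hk, hg, hroot⟩ := hred g
  -- (1) the last Minkowski vector: `c ≤ |m_n|`
  have hlast : c ≤ IdeleClassGroup.ideleNorm K (m (Fin.last n)) := by
    have hξ0 : (Pi.single (Fin.last n) (1 : K) : Fin (n + 1) → K) ≠ 0 := by
      intro h; simpa using congr_fun h (Fin.last n)
    have h := hheight _ (vecMul_ne_zero_of_ne_zero hξ0 (γ⁻¹ : GL (Fin (n + 1)) K))
    rwa [hg, vecHeight_lastMinkowskiRow K γ hu m hk] at h
  -- the root inequalities in `ℝ≥0` with the constant `t₁ ≤ t`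
  have hroot' : ∀ i j : Fin (n + 1), (j : ℕ) = (i : ℕ) + 1 →
      t₁ * IdeleClassGroup.ideleNorm K (m j) ≤ IdeleClassGroup.ideleNorm K (m i) := by
    intro i j hij
    have h := hroot i j hij
    rw [← NNReal.coe_le_coe, NNReal.coe_mul]
    exact le_trans (mul_le_mul_of_nonneg_right ht₁t (NNReal.coe_nonneg _)) h
  -- (2) lower bounds `ℓ ≤ |mᵢ|` by downward induction from the last index
  have hstep : ∀ q : ℕ, ∀ i : Fin (n + 1), (i : ℕ) + q = n →
      t₁ ^ q * c ≤ IdeleClassGroup.ideleNorm K (m i) := by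
    intro q
    induction q with
    | zero =>
      intro i hi0
      have : i = Fin.last n := Fin.ext (by simpa using hi0)
      subst this
      simpa using hlast
    | succ q ih =>
      intro i hiq
      set j : Fin (n + 1) := ⟨(i : ℕ) + 1, by omega⟩ with hj
      have hji : (j : ℕ) = (i : ℕ) + 1 := rfl
      have hjq : (j : ℕ) + q = n := by rw [hji]; omega
      calc t₁ ^ (q + 1) * c = t₁ * (t₁ ^ q * c) := by ring
        _ ≤ t₁ * IdeleClassGroup.ideleNorm K (m j) := mul_le_mul_right (ih j hjq) _
        _ ≤ IdeleClassGroup.ideleNorm K (m i) := hroot' i j hji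
  have hlow : ∀ i : Fin (n + 1), ℓ ≤ IdeleClassGroup.ideleNorm K (m i) := by
    intro i
    have hq : (i : ℕ) + (n - i) = n := by omega
    refine le_trans ?_ (hstep (n - i) i hq)
    exact mul_le_mul_left (pow_le_pow_right_of_le_one' ht₁1 (Nat.sub_le n i)) _
  -- (3) the product bound `∏ |mᵢ| ≤ b / κ`
  have hprod : (∏ i, IdeleClassGroup.ideleNorm K (m i)) ≤ b / κ := by
    rw [le_div_iff₀ hκ]
    have h1 := ideleNorm_det_minkowski (n + 1) K γ hu m k
    rw [← hg] at h1
    calc (∏ i, IdeleClassGroup.ideleNorm K (m i)) * κ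
        ≤ (∏ i, IdeleClassGroup.ideleNorm K (m i)) *
            IdeleClassGroup.ideleNorm K (Matrix.GeneralLinearGroup.det k) := mul_le_mul_right (hκle k hk) _
      _ = IdeleClassGroup.ideleNorm K (Matrix.GeneralLinearGroup.det g) := h1.symm
      _ ≤ b := hdet
  -- (4) upper bounds `|mᵢ| ≤ U`
  have hupp : ∀ i : Fin (n + 1), IdeleClassGroup.ideleNorm K (m i) ≤ U := by
    intro i
    rw [hU, le_div_iff₀ (pow_pos hℓ0 n)]
    refine le_trans ?_ hprod
    have hcard : (Finset.univ.erase i).card = n := by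
      rw [Finset.card_erase_of_mem (Finset.mem_univ i), Finset.card_univ, Fintype.card_fin]; rfl
    calc IdeleClassGroup.ideleNorm K (m i) * ℓ ^ n
        ≤ IdeleClassGroup.ideleNorm K (m i) * ∏ j ∈ Finset.univ.erase i, IdeleClassGroup.ideleNorm K (m j) := by
          refine mul_le_mul_right ?_ _
          have h := Finset.pow_card_le_prod (Finset.univ.erase i)
            (fun j => IdeleClassGroup.ideleNorm K (m j)) ℓ fun j _ => hlow j
          rwa [hcard] at h
      _ = ∏ j, IdeleClassGroup.ideleNorm K (m j) :=
          Finset.mul_prod_erase Finset.univ (fun j => IdeleClassGroup.ideleNorm K (m j)) (Finset.mem_univ i)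
  -- (5) split `mᵢ = mᵢ¹ z(rᵢ)` and bound the real parameters: `lo ≤ rᵢ ≤ hi`
  choose m₁ hm₁ r hmr using fun i => exists_normOneIdeles_mul_posRealIdele (K := K) (m i)
  have hnorm : ∀ i, IdeleClassGroup.ideleNorm K (m i) = (r i : ℝ≥0) ^ d := by
    intro i
    rw [hmr i, map_mul, mem_normOneIdeles.mp (hm₁ i), one_mul, ideleNorm_posRealIdele_holds K (r i)]
  have hr : ∀ i, lo ≤ (r i : ℝ≥0) ∧ (r i : ℝ≥0) ≤ hi := by
    intro i
    rcases le_total (r i : ℝ≥0) 1 with h1 | h1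
    · refine ⟨le_trans (min_le_left _ _) ?_, le_trans h1 (le_max_right _ _)⟩
      exact le_trans (hlow i) (by rw [hnorm i]; exact pow_le_of_le_one zero_le h1 hd0)
    · refine ⟨le_trans (min_le_right _ _) h1, le_trans ?_ (le_max_left _ _)⟩
      exact le_trans (by rw [hnorm i]; exact le_self_pow₀ h1 hd0) (hupp i)
  have hZmem : posRealDiagonal (n + 1) K r ∈ Z := hZ r hr
  -- (6) the rearrangement `g = (γ δ ν) · (c_N c z(r) k)`
  have hdiag : glDiagonal (n + 1) (AdeleRing (𝓞 K) K) m =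
      glDiagonal (n + 1) (AdeleRing (𝓞 K) K) m₁ * posRealDiagonal (n + 1) K r := by
    have hm : m = m₁ * fun i => posRealIdele K (r i) := funext fun i => by rw [Pi.mul_apply, hmr i]
    rw [hm, map_mul, ← posRealDiagonal_apply]
  have hm₁mem : glDiagonal (n + 1) (AdeleRing (𝓞 K) K) m₁ ∈ normOneDiagonal (n + 1) K :=
    mem_normOneDiagonal_iff.mpr ⟨m₁, fun i => mem_normOneIdeles.mp (hm₁ i), rfl⟩
  obtain ⟨κ', cM, hcM, hδc⟩ := hCM _ hm₁mem
  set δ : GL (Fin (n + 1)) (AdeleRing (𝓞 K) K) :=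
    glDiagonal (n + 1) (AdeleRing (𝓞 K) K) (fun i => principalIdele K (κ' i)) with hδ
  have hu' : δ⁻¹ * u * δ ∈ upperUnitriangular (Fin (n + 1)) (AdeleRing (𝓞 K) K) :=
    glDiagonal_inv_mul_mul_glDiagonal_mem_upperUnitriangular _ hu
  obtain ⟨ν, -, cN, hcN, hν⟩ := hCN _ hu'
  set γ' : GL (Fin (n + 1)) (AdeleRing (𝓞 K) K) :=
    Matrix.GeneralLinearGroup.map (algebraMap K (AdeleRing (𝓞 K) K)) γ with hγ'
  set ν' : GL (Fin (n + 1)) (AdeleRing (𝓞 K) K) :=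
    Matrix.GeneralLinearGroup.map (algebraMap K (AdeleRing (𝓞 K) K)) ν with hν'
  set z : GL (Fin (n + 1)) (AdeleRing (𝓞 K) K) := posRealDiagonal (n + 1) K r with hz
  have huδ : u * δ = δ * (ν' * cN) := by
    rw [← hν]
    simp only [mul_assoc, mul_inv_cancel_left]
  have hgeq : g = γ' * δ * ν' * (cN * cM * z * k) :=
    calc g = γ' * u * (δ * cM * z) * k := by rw [hg, hdiag, hδc]
      _ = γ' * (u * δ) * cM * z * k := by simp only [mul_assoc]
      _ = γ' * (δ * (ν' * cN)) * cM * z * k := by rw [huδ]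
      _ = γ' * δ * ν' * (cN * cM * z * k) := by simp only [mul_assoc]
  have hrat : γ' * δ * ν' ∈ rationalPointsGL (n + 1) K :=
    Subgroup.mul_mem _ (Subgroup.mul_mem _ ⟨γ, rfl⟩
      (glDiagonal_principalIdele_mem_rationalPointsGL (n + 1) K κ')) ⟨ν, rfl⟩
  rw [hgeq]
  exact Set.mul_mem_mul hrat (Set.mul_mem_mul (Set.mul_mem_mul (Set.mul_mem_mul hcN hcM) hZmem) hk)

/-- **Mahler's compactness criterion** (adelic `GL_n`, row vectors; Godement, Sém. Bourbaki 257, § 3;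
Borel (1969), Prop. 8.4): for `c > 0` and `b` there is a compact `C ⊆ GL_n(𝔸_K)` with
`{g : h(ξ g) ≥ c ∀ ξ ∈ Kⁿ ∖ 0, |det g|_𝔸 ≤ b} ⊆ GL_n(K) · C`. -/
theorem exists_isCompact_rational_mul (c b : ℝ≥0) (hc : 0 < c) :
    ∃ C : Set (GL (Fin n) (AdeleRing (𝓞 K) K)), IsCompact C ∧
      ∀ g : GL (Fin n) (AdeleRing (𝓞 K) K),
        (∀ ξ : Fin n → K, ξ ≠ 0 →
          c ≤ vecHeight K (principalVec K ξ ᵥ* (g : Matrix (Fin n) (Fin n) (AdeleRing (𝓞 K) K)))) →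
        IdeleClassGroup.ideleNorm K (Matrix.GeneralLinearGroup.det g) ≤ b →
        g ∈ (rationalPointsGL n K : Set (GL (Fin n) (AdeleRing (𝓞 K) K))) * C := by
  cases n with
  | zero =>
    refine ⟨{1}, isCompact_singleton, fun g _ _ => ?_⟩
    have hg : g = 1 := Matrix.GeneralLinearGroup.ext fun i _ => i.elim0
    rw [hg]
    exact Set.mem_mul.mpr ⟨1, Subgroup.one_mem _, 1, Set.mem_singleton 1, mul_one 1⟩
  | succ n => exact exists_isCompact_rational_mul_succ n K c b hc

/-- **Mahler's compactness criterion, column / right version**: for `c > 0` and `b` there is a compact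
`C ⊆ GL_n(𝔸_K)` with `{g : h(g ξ) ≥ c ∀ ξ ∈ Kⁿ ∖ 0, |det g|_𝔸 ≤ b} ⊆ C · GL_n(K)` (transpose of the row
version). -/
theorem exists_isCompact_mul_rational (c b : ℝ≥0) (hc : 0 < c) :
    ∃ C : Set (GL (Fin n) (AdeleRing (𝓞 K) K)), IsCompact C ∧
      ∀ g : GL (Fin n) (AdeleRing (𝓞 K) K),
        (∀ ξ : Fin n → K, ξ ≠ 0 →
          c ≤ vecHeight K ((g : Matrix (Fin n) (Fin n) (AdeleRing (𝓞 K) K)) *ᵥ principalVec K ξ)) →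
        IdeleClassGroup.ideleNorm K (Matrix.GeneralLinearGroup.det g) ≤ b →
        g ∈ C * (rationalPointsGL n K : Set (GL (Fin n) (AdeleRing (𝓞 K) K))) := by
  obtain ⟨C, hC, hmem⟩ := exists_isCompact_rational_mul n K c b hc
  refine ⟨glTranspose '' C, hC.image continuous_glTranspose, fun g hheight hdet => ?_⟩
  have h := hmem (glTranspose g) (fun ξ hξ => by rw [vecMul_glTranspose]; exact hheight ξ hξ)
    (by rw [det_glTranspose]; exact hdet)
  obtain ⟨ρ, ⟨γ, hγ⟩, k, hk, hρk⟩ := Set.mem_mul.mp h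
  have hg : g = glTranspose k * glTranspose ρ := by
    rw [← glTranspose_mul, hρk, glTranspose_glTranspose]
  rw [hg]
  refine Set.mul_mem_mul ⟨k, hk, rfl⟩ ⟨glTranspose γ, ?_⟩
  rw [← hγ, glTranspose_map]

end Mahler

end HodgeCM.PerL34.Mahler

-- port_pkg: scope closed for this part
end
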